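/-
Origin: expansion seat `prover-pub-hodgecm-mc-binder-1-g10-0`, handover #34 2026-08-20T06:21:07Z md5 18342d8b474b (NEW additive KERNEL leaf: `SInstance.S = SGP` at the definiteness guard, pointwise + family; imports installed sinst-1 rows only; drop alone) (`HOME/mc/pub-hodgecm-mc-binder-1-g10/stage43/HodgeCM/Model/Binders/SEqSGP.lean`, md5 18342d8b474b, 84 lines);
landed by the gen-16 packager (p-g16) in gate run 43 as `HodgeCM/Model/Binders/SEqSGP.lean` (verbatim).
-/
/-
Origin: speedrun cell pub-hodgecm, MODEL-CONSTRUCTION sub-cell, unit pub-hodgecm-mc-binder-1-g10 (BINDER PROVER, gen 10; S pin of record),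
seat prover-pub-hodgecm-mc-binder-1-g10-0, 2026-08-20.  Target in PKG: HodgeCM/Model/Binders/SEqSGP.lean (NEW additive leaf; imports the installed
`Model/ThetaAdelicSideGuardedP` + `Model/ThetaAdelicSideInstance` only).  KERNEL ONLY: 2 theorems; 0 records, nothing cited, 0 `def … : Prop`, MODEL-N ±0, E unchanged.
-/
import Summits.HodgeConjecture.HodgeCM.Model.ThetaAdelicSideGuardedP
import Summits.HodgeConjecture.HodgeCM.Model.ThetaAdelicSideInstance

/-!
# The total S pin is the guarded S pin at the definiteness guard

`SInstance.S @hGR @η @hη @hηc @hGR₀..₃ @A V c := thetaAdelicSideOf V c … (A V c) := if h : definite-at-ι₁ then archSideOf … h (A V c) else deg₀`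
and sinst-1's PREDICATE-GUARDED pin `SInstance.SGP @G @hG … @AG V c := thetaAdelicSideOfP V c (G V c) (hG V c) … (AG V c)
:= if hc : G V c then archSideOf … (hG V c hc) (AG V c hc) else deg₀` agree at `G := definite-at-ι₁, hG := id, AG := fun V c _ => A V c`
— NOT by `rfl` (the two `dite`s carry different `Decidable` instances: `instDecidableOr …` vs `Classical.propDecidable _`), but by
`congr` (`Subsingleton (Decidable _)`), pointwise (`S_eq_SGP_apply`) and as FAMILIES (`S_eq_SGP`, the shape of E's row-5 binder).
Use: every binder-1 producer typed at `S := SInstance.S … @A` (#26/#27, #28 r2–#31 r2) transports to the guarded pin at the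
definiteness guard by `S_eq_SGP ▸`; the re-pin to `SROG = SGP @GOG @hG_GOG …` (glue-1 #395/#396) is `K34-PLAN.md` §3 (P1–P3).
-/

set_option autoImplicit false

noncomputable section

namespace HodgeCM.Model.SInstance

open scoped Matrix SchwartzMap
open NumberField NumberField.mixedEmbedding
open Literature.NumberTheory.Automorphic Literature.NumberTheory.Weil1964
open Literature.NumberTheory.GelbartRogawski1991.UnitaryDualPair
open HodgeCM.Adelic HodgeCM.PerL34
open Literature.Geometry.ComplexHyperbolic.BallModel (U21)
open Literature.AlgebraicGeometry.HodgeTheory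
open Literature.NumberTheory.Automorphic.PicardCM


open HodgeCM.Model.ArchSideTerm

variable
  (hGR : ∀ {L : CMField} {ι₁ : L →+* ℂ} (V : HermSpace3 L ι₁) (c : SeesawCtx L),
    (cmSplittingDatum (L : Type) finProdFinEquiv (frameD V) (frameD_real V) (frameD_ne V) (dW c.D) (dW_real c.D)
      (dW_ne c.D)).CompatibleSplitting)
  (η : ∀ {L : CMField} {ι₁ : L →+* ℂ} (V : HermSpace3 L ι₁) (c : SeesawCtx L),
    CMAdelic (L : Type) (frameD V) × CMAdelic (L : Type) (dW c.D) →* ℂˣ)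
  (hη : ∀ {L : CMField} {ι₁ : L →+* ℂ} (V : HermSpace3 L ι₁) (c : SeesawCtx L),
    ∀ γU ∈ CMRat (L : Type) (frameD V), ∀ γ ∈ CMRat (L : Type) (dW c.D), η V c (γU, γ) = 1)
  (hηc : ∀ {L : CMField} {ι₁ : L →+* ℂ} (V : HermSpace3 L ι₁) (c : SeesawCtx L), Continuous fun p => ((η V c p : ℂˣ) : ℂ))
  (hGR₀ : ∀ {L : CMField} {ι₁ : L →+* ℂ} (V : HermSpace3 L ι₁) (c : SeesawCtx L),
    (cmSplittingDatum (L : Type) (e₁) (frameD V) (frameD_real V) (frameD_ne V) (lineVec (L : Type) (dW c.D 0))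
      (fun _ => dW_real c.D 0) (fun _ => dW_ne c.D 0)).CompatibleSplitting)
  (hGR₁ : ∀ {L : CMField} {ι₁ : L →+* ℂ} (V : HermSpace3 L ι₁) (c : SeesawCtx L),
    (cmSplittingDatum (L : Type) (e₁) (frameD V) (frameD_real V) (frameD_ne V) (lineVec (L : Type) (dW c.D 1))
      (fun _ => dW_real c.D 1) (fun _ => dW_ne c.D 1)).CompatibleSplitting)
  (hGR₂ : ∀ {L : CMField} {ι₁ : L →+* ℂ} (V : HermSpace3 L ι₁) (c : SeesawCtx L),
    (cmSplittingDatum (L : Type) (e₁) (frameD V) (frameD_real V) (frameD_ne V) (lineVec (L : Type) (dW' c.D 0))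
      (fun _ => dW'_real c.D 0) (fun _ => dW'_ne c.D 0)).CompatibleSplitting)
  (hGR₃ : ∀ {L : CMField} {ι₁ : L →+* ℂ} (V : HermSpace3 L ι₁) (c : SeesawCtx L),
    (cmSplittingDatum (L : Type) (e₁) (frameD V) (frameD_real V) (frameD_ne V) (lineVec (L : Type) (dW' c.D 1))
      (fun _ => dW'_real c.D 1) (fun _ => dW'_ne c.D 1)).CompatibleSplitting)
  (A : ∀ {L : CMField} {ι₁ : L →+* ℂ} (V : HermSpace3 L ι₁) (c : SeesawCtx L) (k : Fin 4),
    ArchLineInput V (lineRepD V c.D (hGR V c) (hGR₀ V c) (hGR₁ V c) (hGR₂ V c) (hGR₃ V c) (η V c) k))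



/-- pointwise: the total pin is the guarded pin at the definiteness guard (the `dite`s differ only by their `Decidable` instances, `congr` closes it by `Subsingleton.elim`). -/
theorem S_eq_SGP_apply {L : CMField} {ι₁ : L →+* ℂ} (V : HermSpace3 L ι₁) (c : SeesawCtx L) : S @hGR @η @hη @hηc @hGR₀ @hGR₁ @hGR₂ @hGR₃ @A V c =
      SGP @(fun {L : CMField} {ι₁ : L →+* ℂ} (_V : HermSpace3 L ι₁) (c : SeesawCtx L) => (∀ j, 0 < (ι₁ (dW c.D j)).re) ∨ ∀ j, (ι₁ (dW c.D j)).re < 0)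
        @(fun {L : CMField} {ι₁ : L →+* ℂ} (_V : HermSpace3 L ι₁) (_c : SeesawCtx L) h => h) @hGR @η @hη @hηc @hGR₀ @hGR₁ @hGR₂ @hGR₃
        @(fun {L : CMField} {ι₁ : L →+* ℂ} (V : HermSpace3 L ι₁) (c : SeesawCtx L) _ => A V c) V c := by
  unfold S SGP thetaAdelicSideOf thetaAdelicSideOfP
  congr 1

/-- as FAMILIES (the shape of E's row-5 binder). -/
theorem S_eq_SGP : (fun {L : CMField} {ι₁ : L →+* ℂ} (V : HermSpace3 L ι₁) (c : SeesawCtx L) => S @hGR @η @hη @hηc @hGR₀ @hGR₁ @hGR₂ @hGR₃ @A V c) =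
    fun {L : CMField} {ι₁ : L →+* ℂ} (V : HermSpace3 L ι₁) (c : SeesawCtx L) =>
      SGP @(fun {L : CMField} {ι₁ : L →+* ℂ} (_V : HermSpace3 L ι₁) (c : SeesawCtx L) => (∀ j, 0 < (ι₁ (dW c.D j)).re) ∨ ∀ j, (ι₁ (dW c.D j)).re < 0)
        @(fun {L : CMField} {ι₁ : L →+* ℂ} (_V : HermSpace3 L ι₁) (_c : SeesawCtx L) h => h) @hGR @η @hη @hηc @hGR₀ @hGR₁ @hGR₂ @hGR₃
        @(fun {L : CMField} {ι₁ : L →+* ℂ} (V : HermSpace3 L ι₁) (c : SeesawCtx L) _ => A V c) V c := by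
  funext L ι₁ V c
  exact S_eq_SGP_apply @hGR @η @hη @hηc @hGR₀ @hGR₁ @hGR₂ @hGR₃ @A V c

end HodgeCM.Model.SInstance

end
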